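import Summits.CriticalPhenomena.CardyFormulaZ2.Theorems.CardyMeckeFlipMeckeRigidityTranslationErgodic
import Summits.CriticalPhenomena.CardyFormulaZ2.Theorems.CardyMeckeFlipMeckeRigidityCylinderApprox
import Mathlib.Dynamics.Ergodic.Ergodic

/-!
# Flip-extremal isometry-invariant laws are ergodic under every translation

Route `Summits/CriticalPhenomena/CardyFormulaZ2/Theses/CardyMeckeFlip`, crux `MeckeRigidity`
(item stmt-CriticalPhenomena-14826), line `registered`, stub `stub_crossingUniqueness` (helper; the
capstone of the "extremal ⟹ ergodic" package).

Under the hypotheses of the crux that concern the law `P` on `ℋ_ℂ` and its kernel family `M` —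
(E2) isometry invariance, (ADM), (F) at every cutoff, (EXT) — every translation `S ↦ v + S`,
`v ≠ 0`, is an ERGODIC measure-preserving transformation of `(ℋ_ℂ, P)` in Mathlib's sense
(`ergodic_isometry_addLeft`; registered `∀`-form `ergodic_isometry_addLeft_of_isFlipExtremal`):
every translation-invariant Borel subset of the Schramm–Smirnov space is `P`-trivial.  With
Birkhoff's theorem this upgrades the cylinder-function statement of `…TranslationErgodic` to all
of `L¹(P)`.  Neither (D), nor RSW, nor the equivariance of the kernel is used.

Proof.  (1) CYLINDER APPROXIMATION OF BOREL INDICATORS (`exists_quadPattern_approx_indicator`, file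
`…MeckeRigidityCylinderApprox`, any finite Borel measure on `ℋ_ℂ`): the sets whose indicator is an `L¹(P)`-limit of `[0,1]`-valued
cylinder functions `S ↦ G {j | Qf j ∈ S}` form a Dynkin system (complements: `1 − G`; countable
disjoint unions: a vanishing tail `⋃_{i ≥ n} f i` plus finitely many heads, appended and clamped
to `[0,1]`) containing the `π`-system of finite intersections of crossing events (whose indicators
ARE `{0,1}`-cylinder functions), which generates the Borel `σ`-field (Schramm–Smirnov Thm. 1.4 (2),
tree: `borel_eq_generateFrom_generatePiSystem_crossedEvent`).  (2) For an invariant set `A`,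
`1_A = 1_A ∘ τᵏ` and `P ∘ τ⁻ᵏ = P`, so the translated approximants — cylinder functions of the
quads `Qf j − k v`, which leave every ball — approximate `1_A` equally well: `1_A` is far-cylinder
approximable, hence a.s. constant by the tail-triviality theorem
`ae_eq_const_of_farCylinderApprox` ((F) + (EXT)), i.e. `A` is trivial.
-/

noncomputable section

open MeasureTheory Set Metric Filter Topology
open scoped ENNReal NNReal
open Literature.Probability.Percolation Literature.Probability.Percolation.QuadCrossing

namespace Summit.CriticalPhenomena.CardyFormulaZ2.Theorems.CardyMeckeFlip

/-! ### Ergodicity of translations -/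

/-- **Flip-extremal isometry-invariant laws are ergodic under every translation.**  Under (E2),
(ADM), (F) at every cutoff and (EXT), for every `v ≠ 0` the translation `S ↦ v + S` of the
Schramm–Smirnov space is an ERGODIC measure-preserving map of `(ℋ_ℂ, P)`: every translation
invariant Borel set is trivial.  Proof: the indicator of an invariant set is, by cylinder
approximation of Borel indicators and invariance + measure preservation, far-cylinder approximable,
hence a.s. constant by the tail-triviality theorem. [folklore] -/
theorem ergodic_isometry_addLeft {P : Measure (QuadConfig (univ : Set ℂ))} [IsProbabilityMeasure P]
    {M : ℝ → QuadConfig (univ : Set ℂ) → Measure ℂ}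
    (hE2 : ∀ g : ℂ ≃ᵢ ℂ, Measure.map (QuadConfig.isometry g) P = P)
    (hADM : IsAdmissibleKernel P M) (hF : ∀ ε : ℝ, 0 < ε → IsFlipFairKernel P (M ε))
    (hEXT : IsFlipExtremal P M) {v : ℂ} (hv : v ≠ 0) :
    Ergodic (QuadConfig.isometry (IsometryEquiv.addLeft v)) P := by
  set τ : QuadConfig (univ : Set ℂ) → QuadConfig (univ : Set ℂ) :=
    QuadConfig.isometry (IsometryEquiv.addLeft v) with hτ
  have hτmp : MeasurePreserving τ P P := measurePreserving_isometry_of_map_eq _ (hE2 _)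
  refine ⟨hτmp, ⟨fun A hA hinv => ?_⟩⟩
  -- the indicator of the invariant set
  set h : QuadConfig (univ : Set ℂ) → ℝ := A.indicator 1 with hhdef
  have hhm : Measurable h := measurable_one.indicator hA
  have hh : ∀ S, 0 ≤ h S ∧ h S ≤ 1 := fun S =>
    ⟨Set.indicator_nonneg (fun _ _ => zero_le_one) S, Set.indicator_le_self' (fun _ _ => zero_le_one) S⟩
  have hh_inv : ∀ k S, h (τ^[k] S) = h S := by
    intro k S
    induction k generalizing S with
    | zero => rfl
    | succ k ih =>
      rw [Function.iterate_succ_apply, ih]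
      simp only [hhdef]
      conv_rhs => rw [← hinv]
      rfl
  -- far-cylinder approximability of `h`
  have happrox : ∀ (r : ℕ) (δ : ℝ), 0 < δ → ∃ (m : ℕ) (Qf : Fin m → Quad (univ : Set ℂ))
      (G : Set (Fin m) → ℝ), (∀ B, 0 ≤ G B ∧ G B ≤ 1) ∧
        (∀ j, Disjoint (Qf j).carrier (Metric.closedBall (0 : ℂ) r)) ∧
          ∫ S, |h S - G {j | Qf j ∈ S}| ∂P ≤ δ := by
    intro r δ hδ
    obtain ⟨m, Qf, G, hG, hle⟩ := exists_quadPattern_approx_indicator P hA δ hδ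
    obtain ⟨k₀, hk₀⟩ := exists_forall_disjoint_carrier_iterate_translate hv Qf r
    refine ⟨m, fun j => ((fun Q : Quad (univ : Set ℂ) =>
        Q.mapHomeomorph (IsometryEquiv.addLeft v).toHomeomorph.symm)^[k₀] (Qf j)), G, hG,
      fun j => hk₀ k₀ le_rfl j, ?_⟩
    -- the shifted approximant is `c ∘ τ^{k₀}`; invariance of `h` and of `P`
    have hshift : ∀ S, G {j | ((fun Q : Quad (univ : Set ℂ) =>
        Q.mapHomeomorph (IsometryEquiv.addLeft v).toHomeomorph.symm)^[k₀] (Qf j)) ∈ S} =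
          G {j | Qf j ∈ τ^[k₀] S} := by
      intro S
      congr 1
      ext j
      simp only [mem_setOf_eq]
      rw [mem_iterate_isometry_iff]
    simp_rw [hshift]
    have hmp := hτmp.iterate k₀
    have hmeas' : AEStronglyMeasurable (fun S => |h S - G {j | Qf j ∈ S}|) (Measure.map (τ^[k₀]) P) := by
      rw [hmp.map_eq]
      exact ((hhm.sub (measurable_comp_quadPattern Qf G)).norm).aestronglyMeasurable
    have hcomp := integral_map hmp.measurable.aemeasurable hmeas'
    rw [hmp.map_eq] at hcomp
    have key : ∫ S, |h S - G {j | Qf j ∈ τ^[k₀] S}| ∂P = ∫ S, |h S - G {j | Qf j ∈ S}| ∂P := by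
      rw [hcomp]
      refine integral_congr_ae (ae_of_all _ fun S => ?_)
      simp only [hh_inv k₀ S]
    rw [key]
    exact hle
  -- tail triviality: `1_A` is a.s. constant, so `A` is trivial
  have hconst := ae_eq_const_of_farCylinderApprox hADM hF hEXT hhm hh happrox
  rw [eventuallyConst_set']
  by_cases hA0 : P A = 0
  · exact Or.inl (ae_eq_empty.2 hA0)
  · right
    -- some point of `A` carries the a.s. equality, so the constant is `1`
    have hpos : ∃ S, S ∈ A ∧ h S = ∫ S, h S ∂P := by
      by_contra hno
      push Not at hno
      have : ∀ᵐ S ∂P, S ∉ A := by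
        filter_upwards [hconst] with S hS hSA
        exact hno S hSA hS
      exact hA0 (measure_eq_zero_iff_ae_notMem.2 this)
    obtain ⟨S₀, hS₀, hc⟩ := hpos
    rw [hhdef, Set.indicator_of_mem hS₀, Pi.one_apply] at hc
    refine ae_eq_univ.2 (measure_eq_zero_iff_ae_notMem.2 ?_)
    filter_upwards [hconst] with S hS hSA
    rw [← hc, hhdef, Set.indicator_of_notMem hSA] at hS
    exact zero_ne_one hS
/-- **Birkhoff along translations, for every integrable observable**: under (E2), (ADM), (F) at
every cutoff and (EXT), for `v ≠ 0` and `F ∈ L¹(P)` the Birkhoff averages `N⁻¹ Σ_{k<N} F(S + k v)`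
converge `P`-a.s. to `∫ F dP` (ergodicity + Birkhoff's pointwise ergodic theorem,
Literature `birkhoff_ergodic_theorem_of_ergodic_holds`). [folklore] -/
theorem ae_tendsto_birkhoffAverage_of_integrable {P : Measure (QuadConfig (univ : Set ℂ))}
    [IsProbabilityMeasure P] {M : ℝ → QuadConfig (univ : Set ℂ) → Measure ℂ}
    (hE2 : ∀ g : ℂ ≃ᵢ ℂ, Measure.map (QuadConfig.isometry g) P = P)
    (hADM : IsAdmissibleKernel P M) (hF : ∀ ε : ℝ, 0 < ε → IsFlipFairKernel P (M ε))
    (hEXT : IsFlipExtremal P M) {v : ℂ} (hv : v ≠ 0) {F : QuadConfig (univ : Set ℂ) → ℝ}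
    (hFi : Integrable F P) :
    ∀ᵐ S ∂P, Tendsto (fun N => birkhoffAverage ℝ (QuadConfig.isometry (IsometryEquiv.addLeft v)) F N S)
      atTop (𝓝 (∫ S, F S ∂P)) :=
  Literature.Dynamics.Ergodic.birkhoff_ergodic_theorem_of_ergodic_holds P _
    (ergodic_isometry_addLeft hE2 hADM hF hEXT hv) F hFi

/-- **Registered form** (sub-goal `ergodic_isometry_addLeft_of_isFlipExtremal` of item
stmt-CriticalPhenomena-14826): under (E2), (ADM), (F) at every cutoff and (EXT), every
translation `S ↦ v + S`, `v ≠ 0`, is an ergodic measure-preserving map of `(ℋ_ℂ, P)`.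
[folklore] -/
theorem ergodic_isometry_addLeft_of_isFlipExtremal : ∀ (P : Measure (QuadConfig (Set.univ : Set ℂ))) (M : ℝ → QuadConfig (Set.univ : Set ℂ) → Measure ℂ), IsProbabilityMeasure P → (∀ g : ℂ ≃ᵢ ℂ, Measure.map (QuadConfig.isometry g) P = P) → IsAdmissibleKernel P M → (∀ ε : ℝ, 0 < ε → IsFlipFairKernel P (M ε)) → IsFlipExtremal P M → ∀ (v : ℂ), v ≠ 0 → Ergodic (QuadConfig.isometry (IsometryEquiv.addLeft v)) P := by
  intro P M hP hE2 hADM hF hEXT v hv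
  exact ergodic_isometry_addLeft hE2 hADM hF hEXT hv

end Summit.CriticalPhenomena.CardyFormulaZ2.Theorems.CardyMeckeFlip

end
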